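import Summits.HodgeConjecture.CorCM.MultiFieldWeilNonIsomorphicOctics
import Summits.HodgeConjecture.CorCM.MultiFieldWeilSimpleSlots
import Summits.HodgeConjecture.CorCM.MultiFieldWeilTwinsMenu
import HarnessLib

/-!
# MULTI-FIELD WEIL ENGINE — THE MENU WITH `Hom = ∅` IN EVERY DEGREE: sextic, octic (`𝔄₄`/`𝔖₄` quartic part) and decic CM fields through `k`, pairwise without
# homomorphisms within each degree — the Hodge conjecture for every product of copies, given only Markman's two theorems

Cell `pub-hodgecm2` (COR-CM), seat b30 gen 39 (2026-08-25); count-neutral own lane MULTI-FIELD WEIL ENGINE (stem `MultiFieldWeil*`), the geometric consumer of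
`CorCM/MultiFieldWeilNonIsomorphicOctics.lean` (the 𝔖₄ lemma `exists_outside_normalClosure_of_isEmpty_ringHom_four`: non-isomorphic octic CM fields through `k`, one with
`2`-transitive quartic part, lie outside each other's Galois closures) on top of Z3 (`CorCM/MultiFieldWeilOcticSlotsHeadline.lean`), Z4 (`…OcticSlotsDegreeForm`), Y6 §3
(`…SimpleSlots`, the quotable form) and T3c (`…TwinsMenu`).  Theorems only; no definition, no named fact, no `sorry`.  HONEST FRAMING: every headline is conditional ONLY on the
two displayed binders `Markman2025_weilClasses_algebraic_abelianFourfold` (sextic `(1,2)`, octic `(2,2)` slots) and `Markman2025_weilClasses_algebraic_hyperbolicSixfold` (octic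
`(1,3)`, decic `(2,3)` slots); `HC_CM` is NOT proved and not asserted.

WHAT CHANGES.  In Z3 ∕ Z4 ∕ Y6 ∕ T3c the octic–octic pairs `m₀ ≠ m` carried the hypothesis «some `τ`-embedding of `K_m` takes a value outside `L(K_{m₀})`»; it is now
`Hom(K_m, K_{m₀}) = ∅`, exactly as for the sextic and decic pairs.  The ONE closure hypothesis left is for `K_{m₀}` OCTIC and `K_m` SEXTIC (the cubic-resolvent obstruction:
`K_m = k·C` with `C` the resolvent cubic of the quartic part of `K_{m₀}` does lie inside `L(K_{m₀})`, and then `𝔖₄ ↠ 𝔖₃` ∕ `𝔄₄ ↠ C₃` kills stabiliser-transitivity).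

§1 `hodgeConjectureFor_biproduct_comp_of_sexticsOcticsDecics_of_isEmpty_ringHom_of_octics` (+ dominated; + degree form `…_of_finrank_pair`): `E` + any number of slots
   of types `(3,1), (4,1), (4,2), (5,2)` over CM fields through `k`; every octic field with `2`-transitive quartic part; `Hom = ∅` between distinct slots of EQUAL degree;
   octic → sextic closure hypothesis ⟹ HC for every product of copies.
§2 `hodgeConjectureFor_biproduct_comp_of_octics_of_isEmpty_ringHom_of_finrank_pair` (+ dominated): OCTIC FIELDS ONLY — any number of CM fourfolds of `k`-signature
   `(1,3)` ∕ `(2,2)` over PAIRWISE NON-ISOMORPHIC octic CM fields through `k`, each with two `τ`-embeddings of joint degree `24` ⟹ HC for every product of copies with `E`.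
§3 `hodgeConjectureFor_biproduct_comp_menu_of_isSimple_of_isEmpty_ringHom` (+ dominated): THE QUOTABLE FORM — `E` + SIMPLE CM threefolds (sextic fields ∋ `k`) + SIMPLE
   CM fourfolds (octic fields ∋ `k`, degree-`24` pair) + CM fivefolds of `k`-signature `(2,3)`/`(3,2)` (decic fields ∋ `k`), fields PAIRWISE NON-ISOMORPHIC within each
   degree, octic → sextic closure hypothesis ⟹ HC for every product of copies and everything dominated, mod Markman 4 + 6.
§4 `hodgeConjectureFor_biproduct_comp_of_twinsMenu_of_isEmpty_ringHom` : T3c's sextic twin pairs inside the menu, same upgrade.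

[cite: Markman2025SurveySecant, Thm. 1.2] [cite: Markman2025SecantWeil, Thm 1.5.1] [cite: Pohlmann1968, Thm 1] [cite: MoonenZarhin1995Duke, Thm. 2.4] [cite: MumfordAV1970, §19]
[cite: DixonMortimer1996, §1.4 Ex. 1.4.1–1.4.2; §2.1; §3.3, Thm. 3.3A] [cite: Lang2002, VI §1 Thm. 1.1, Cor. 1.6; V §2 Thm. 2.8] [cite: Dodson1984, §1.1 Imprimitivity Theorem and §5.1.2 Theorem]
[cite: Shimura1998, §8.2 Prop. 26, §18.2 Lemma (i)] [cite: Deligne1982HodgeCycles, §5 (b)]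

## References
* [Markman2025SurveySecant] E. Markman, arXiv:2509.23403, Thm. 1.2.  [Markman2025SecantWeil] E. Markman, Cycles on abelian 2n-folds of Weil type from secant sheaves on abelian
  n-folds, Thm 1.5.1.  [Pohlmann1968] H. Pohlmann, Ann. of Math. 88 (1968), Thm 1.  [MoonenZarhin1995Duke] B. Moonen, Yu. Zarhin, Duke Math. J. 77 (1995), Thm. 2.4.
  [MumfordAV1970] D. Mumford, *Abelian Varieties*, §19.
* [DixonMortimer1996] J. D. Dixon, B. Mortimer, *Permutation Groups*, GTM 163, §1.4, §2.1, §3.3 Thm. 3.3A.  [Lang2002] S. Lang, *Algebra*, GTM 211, V §2 Thm. 2.8, VI §1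
  Thm. 1.1, Cor. 1.6.  [Dodson1984] B. Dodson, Trans. AMS 283 (1984), §1.1, §5.1.2.  [Shimura1998] G. Shimura, *Abelian varieties with complex multiplication and modular
  functions*, §8.2 Prop. 26, §18.2.  [Deligne1982HodgeCycles] P. Deligne, Hodge cycles on abelian varieties, LNM 900 (1982), §5 (b).
-/

noncomputable section

open CategoryTheory CategoryTheory.Limits NumberField IntermediateField

namespace Summit.HodgeConjecture.CorCM.MultiFieldWeil

open Finset
open Literature.AlgebraicGeometry Literature.AlgebraicGeometry.Motives Literature.AlgebraicGeometry.HodgeTheory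
open Literature.AlgebraicGeometry.ComplexMultiplication (IsCMTypeRealisation)
open Literature.AlgebraicTopology.SingularHomology
open Literature.NumberTheory.ComplexMultiplication
open Summit.HodgeConjecture.CorCM.Census.MultiFieldWeil

open scoped Classical

/-! ## §1 The sextic + octic + decic headline with `Hom = ∅` for all pairs of equal degree -/

section Headline

variable {I : Type} {r : ℕ} {Kf : I → Type} [∀ i, Field (Kf i)] [∀ i, NumberField (Kf i)] [∀ i, IsCMField (Kf i)]
  {i₀ : I} {is : Fin r → I} {τ : Kf i₀ →+* ℂ}
  {A : Fin (r + 1) → AbelianVariety ℂ} {Φ : ∀ j : Fin (r + 1), CMType (Kf (mfSlots i₀ is j))}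
  {ι : ∀ j, 𝓞 (Kf (mfSlots i₀ is j)) →+* End (A j)}
  {θ : ∀ j, Kf (mfSlots i₀ is j) →+* Module.End ℂ (complexBetti (A j).X 1)}

/-- **HEADLINE — SIMPLE CM THREEFOLDS (SEXTIC FIELDS), `(1,3)`- AND `(2,2)`-FOURFOLDS OVER OCTIC FIELDS WITH `2`-TRANSITIVE QUARTIC PART, `(2,3)`-FIVEFOLDS (DECIC
FIELDS), ALL THROUGH `k`, PAIRWISE WITHOUT HOMOMORPHISMS IN EACH DEGREE; GIVEN ONLY MARKMAN'S TWO THEOREMS.**  `k = Kf i₀` imaginary quadratic, `E = A 0 ⊨ (k; {τ})`,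
`B_m = A (m+1) ⊨ (K_m; Φ (m+1))`, `[K_m : ℚ] = 2 n_m`, `(n_m, p_m) ∈ {(3,1), (4,1), (4,2), (5,2)}`.  HYPOTHESES: (i) for every octic `K_m` the automorphisms of `ℂ` over `τ(k)`
are `2`-transitive on its `τ`-embeddings (quartic part `𝔄₄` or `𝔖₄`); (ii) `Hom(K_m, K_{m₀}) = ∅` for `m₀ ≠ m` of EQUAL degree (sextic W1 §3, octic §4, decic Y1 §1);
(iii) for `K_{m₀}` octic and `K_m` sextic some `τ`-embedding of `K_m` takes some value outside `L(K_{m₀})` (the cubic resolvent obstruction).  Then the Hodge conjecture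
holds for EVERY product of copies `E^a × ∏_m B_m^{b_m}`.  `HC_CM` is NOT asserted.  NOT covered: octic fields with quartic part `C₄`, `V₄`, `D₄`; several non-isogenous
factors over isomorphic fields. [cite: Markman2025SurveySecant, Thm. 1.2] [cite: Markman2025SecantWeil, Thm 1.5.1] [cite: Pohlmann1968, Thm 1] [cite: MoonenZarhin1995Duke, Thm. 2.4]
[cite: DixonMortimer1996, §1.4 Ex. 1.4.1–1.4.2; §2.1; §3.3, Thm. 3.3A] [cite: Lang2002, VI §1 Thm. 1.1 and Cor. 1.6] -/
theorem hodgeConjectureFor_biproduct_comp_of_sexticsOcticsDecics_of_isEmpty_ringHom_of_octics (hW4 : Markman2025_weilClasses_algebraic_abelianFourfold)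
    (hM6 : Markman2025_weilClasses_algebraic_hyperbolicSixfold) (n p : Fin r → ℕ)
    (hnp : ∀ m, (n m = 3 ∧ p m = 1) ∨ (n m = 4 ∧ p m = 1) ∨ (n m = 4 ∧ p m = 2) ∨ (n m = 5 ∧ p m = 2))
    {N : ℕ} (κ : Fin N → Fin (r + 1)) (h2 : Module.finrank ℚ (Kf i₀) = 2) (hdeg : ∀ m : Fin r, Module.finrank ℚ (Kf (is m)) = 2 * n m)
    (im : ∀ m : Fin r, Kf i₀ →+* Kf (is m)) (hA : ∀ j, IsCMTypeRealisation (Φ j) (A j) (ι j) (θ j)) (hΨ : ∀ σ : Kf i₀ →+* ℂ, σ ∈ (Φ 0).1 ↔ σ = τ)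
    (hp : ∀ m : Fin r, (Finset.univ.filter fun s : Kf (is m) →+* ℂ => s.comp (im m) = τ ∧ s ∈ (Φ m.succ).1).card = p m)
    (h2T : ∀ m : Fin r, n m = 4 → ∀ s₁ s₂ s₁' s₂' : Kf (is m) →+* ℂ, s₁.comp (im m) = τ → s₂.comp (im m) = τ → s₁'.comp (im m) = τ →
      s₂'.comp (im m) = τ → s₁ ≠ s₂ → s₁' ≠ s₂' → ∃ ρ : ℂ ≃+* ℂ, (ρ : ℂ →+* ℂ).comp τ = τ ∧ (ρ : ℂ →+* ℂ).comp s₁ = s₁' ∧ (ρ : ℂ →+* ℂ).comp s₂ = s₂')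
    (hiso : ∀ (m₀ m : Fin r), m₀ ≠ m → n m₀ = n m → IsEmpty (Kf (is m) →+* Kf (is m₀)))
    (hout43 : ∀ (m₀ m : Fin r), m₀ ≠ m → n m₀ = 4 → n m = 3 →
      ∃ s : Kf (is m) →+* ℂ, s.comp (im m) = τ ∧ ∃ x, s x ∉ normalClosure ℚ (Kf (is m₀)) ℂ) :
    HodgeConjectureFor (⨁ fun j => A (κ j)).dim (⨁ fun j => A (κ j)).X := by
  refine hodgeConjectureFor_biproduct_comp_of_sexticsOcticsDecics_of_isEmpty_ringHom hW4 hM6 n p hnp κ h2 hdeg im hA hΨ hp h2T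
    (fun m₀ m hm hnm _ => hiso m₀ m hm hnm) fun m₀ m hm h4₀ hnm => ?_
  rcases hnm with h4 | h3
  · exact exists_outside_normalClosure_of_isEmpty_ringHom_four h2 hdeg im m₀ m h4₀ h4 (h2T m₀ h4₀) (hiso m₀ m hm (h4₀.trans h4.symm))
  · exact hout43 m₀ m hm h4₀ h3

/-- **Dominated form.** [cite: Markman2025SurveySecant, Thm. 1.2] [cite: Markman2025SecantWeil, Thm 1.5.1] [cite: MumfordAV1970, §19] -/
theorem hodgeConjectureFor_of_avDominatedBy_comp_of_sexticsOcticsDecics_of_isEmpty_ringHom_of_octics (hW4 : Markman2025_weilClasses_algebraic_abelianFourfold)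
    (hM6 : Markman2025_weilClasses_algebraic_hyperbolicSixfold) (n p : Fin r → ℕ)
    (hnp : ∀ m, (n m = 3 ∧ p m = 1) ∨ (n m = 4 ∧ p m = 1) ∨ (n m = 4 ∧ p m = 2) ∨ (n m = 5 ∧ p m = 2))
    {N : ℕ} (κ : Fin N → Fin (r + 1)) (h2 : Module.finrank ℚ (Kf i₀) = 2) (hdeg : ∀ m : Fin r, Module.finrank ℚ (Kf (is m)) = 2 * n m)
    (im : ∀ m : Fin r, Kf i₀ →+* Kf (is m)) (hA : ∀ j, IsCMTypeRealisation (Φ j) (A j) (ι j) (θ j)) (hΨ : ∀ σ : Kf i₀ →+* ℂ, σ ∈ (Φ 0).1 ↔ σ = τ)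
    (hp : ∀ m : Fin r, (Finset.univ.filter fun s : Kf (is m) →+* ℂ => s.comp (im m) = τ ∧ s ∈ (Φ m.succ).1).card = p m)
    (h2T : ∀ m : Fin r, n m = 4 → ∀ s₁ s₂ s₁' s₂' : Kf (is m) →+* ℂ, s₁.comp (im m) = τ → s₂.comp (im m) = τ → s₁'.comp (im m) = τ →
      s₂'.comp (im m) = τ → s₁ ≠ s₂ → s₁' ≠ s₂' → ∃ ρ : ℂ ≃+* ℂ, (ρ : ℂ →+* ℂ).comp τ = τ ∧ (ρ : ℂ →+* ℂ).comp s₁ = s₁' ∧ (ρ : ℂ →+* ℂ).comp s₂ = s₂')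
    (hiso : ∀ (m₀ m : Fin r), m₀ ≠ m → n m₀ = n m → IsEmpty (Kf (is m) →+* Kf (is m₀)))
    (hout43 : ∀ (m₀ m : Fin r), m₀ ≠ m → n m₀ = 4 → n m = 3 →
      ∃ s : Kf (is m) →+* ℂ, s.comp (im m) = τ ∧ ∃ x, s x ∉ normalClosure ℚ (Kf (is m₀)) ℂ)
    {X : AbelianVariety ℂ} (hX : Domination.AVDominatedBy X (⨁ fun j => A (κ j))) : HodgeConjectureFor X.dim X.X :=
  Domination.hodgeConjectureFor_of_avDominatedBy
    (hodgeConjectureFor_biproduct_comp_of_sexticsOcticsDecics_of_isEmpty_ringHom_of_octics hW4 hM6 n p hnp κ h2 hdeg im hA hΨ hp h2T hiso hout43) hX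

/-- **Degree form**: (i) from ONE degree — for every octic `K_m` two distinct `τ`-embeddings `s₀, t₀` with `[ℚ(τk)·s₀(K_m)·t₀(K_m) : ℚ] = 24` (Z4). `HC_CM` is NOT asserted.
[cite: Markman2025SurveySecant, Thm. 1.2] [cite: Markman2025SecantWeil, Thm 1.5.1] [cite: Lang2002, VI §1 Thm. 1.1, Cor. 1.6 and V §2 Thm. 2.8] [cite: DixonMortimer1996, §1.4; §2.1] -/
theorem hodgeConjectureFor_biproduct_comp_of_sexticsOcticsDecics_of_isEmpty_ringHom_of_octics_of_finrank_pair
    (hW4 : Markman2025_weilClasses_algebraic_abelianFourfold) (hM6 : Markman2025_weilClasses_algebraic_hyperbolicSixfold) (n p : Fin r → ℕ)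
    (hnp : ∀ m, (n m = 3 ∧ p m = 1) ∨ (n m = 4 ∧ p m = 1) ∨ (n m = 4 ∧ p m = 2) ∨ (n m = 5 ∧ p m = 2))
    {N : ℕ} (κ : Fin N → Fin (r + 1)) (h2 : Module.finrank ℚ (Kf i₀) = 2) (hdeg : ∀ m : Fin r, Module.finrank ℚ (Kf (is m)) = 2 * n m)
    (im : ∀ m : Fin r, Kf i₀ →+* Kf (is m)) (hA : ∀ j, IsCMTypeRealisation (Φ j) (A j) (ι j) (θ j)) (hΨ : ∀ σ : Kf i₀ →+* ℂ, σ ∈ (Φ 0).1 ↔ σ = τ)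
    (hp : ∀ m : Fin r, (Finset.univ.filter fun s : Kf (is m) →+* ℂ => s.comp (im m) = τ ∧ s ∈ (Φ m.succ).1).card = p m)
    (h24 : ∀ m : Fin r, n m = 4 → ∃ s₀ t₀ : Kf (is m) →+* ℂ, s₀.comp (im m) = τ ∧ t₀.comp (im m) = τ ∧ s₀ ≠ t₀ ∧
      Module.finrank ℚ ↥(adjoin ℚ (Set.range τ) ⊔ adjoin ℚ (Set.range s₀ ∪ Set.range t₀)) = 24)
    (hiso : ∀ (m₀ m : Fin r), m₀ ≠ m → n m₀ = n m → IsEmpty (Kf (is m) →+* Kf (is m₀)))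
    (hout43 : ∀ (m₀ m : Fin r), m₀ ≠ m → n m₀ = 4 → n m = 3 →
      ∃ s : Kf (is m) →+* ℂ, s.comp (im m) = τ ∧ ∃ x, s x ∉ normalClosure ℚ (Kf (is m₀)) ℂ) :
    HodgeConjectureFor (⨁ fun j => A (κ j)).dim (⨁ fun j => A (κ j)).X :=
  hodgeConjectureFor_biproduct_comp_of_sexticsOcticsDecics_of_isEmpty_ringHom_of_octics hW4 hM6 n p hnp κ h2 hdeg im hA hΨ hp
    (fun m h4 => h2T_of_finrank_pair_octic h2 im hdeg h24 m h4) hiso hout43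

/-- **Dominated form, degree form.** [cite: Markman2025SurveySecant, Thm. 1.2] [cite: Markman2025SecantWeil, Thm 1.5.1] [cite: MumfordAV1970, §19] -/
theorem hodgeConjectureFor_of_avDominatedBy_comp_of_sexticsOcticsDecics_of_isEmpty_ringHom_of_octics_of_finrank_pair
    (hW4 : Markman2025_weilClasses_algebraic_abelianFourfold) (hM6 : Markman2025_weilClasses_algebraic_hyperbolicSixfold) (n p : Fin r → ℕ)
    (hnp : ∀ m, (n m = 3 ∧ p m = 1) ∨ (n m = 4 ∧ p m = 1) ∨ (n m = 4 ∧ p m = 2) ∨ (n m = 5 ∧ p m = 2))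
    {N : ℕ} (κ : Fin N → Fin (r + 1)) (h2 : Module.finrank ℚ (Kf i₀) = 2) (hdeg : ∀ m : Fin r, Module.finrank ℚ (Kf (is m)) = 2 * n m)
    (im : ∀ m : Fin r, Kf i₀ →+* Kf (is m)) (hA : ∀ j, IsCMTypeRealisation (Φ j) (A j) (ι j) (θ j)) (hΨ : ∀ σ : Kf i₀ →+* ℂ, σ ∈ (Φ 0).1 ↔ σ = τ)
    (hp : ∀ m : Fin r, (Finset.univ.filter fun s : Kf (is m) →+* ℂ => s.comp (im m) = τ ∧ s ∈ (Φ m.succ).1).card = p m)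
    (h24 : ∀ m : Fin r, n m = 4 → ∃ s₀ t₀ : Kf (is m) →+* ℂ, s₀.comp (im m) = τ ∧ t₀.comp (im m) = τ ∧ s₀ ≠ t₀ ∧
      Module.finrank ℚ ↥(adjoin ℚ (Set.range τ) ⊔ adjoin ℚ (Set.range s₀ ∪ Set.range t₀)) = 24)
    (hiso : ∀ (m₀ m : Fin r), m₀ ≠ m → n m₀ = n m → IsEmpty (Kf (is m) →+* Kf (is m₀)))
    (hout43 : ∀ (m₀ m : Fin r), m₀ ≠ m → n m₀ = 4 → n m = 3 →
      ∃ s : Kf (is m) →+* ℂ, s.comp (im m) = τ ∧ ∃ x, s x ∉ normalClosure ℚ (Kf (is m₀)) ℂ)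
    {X : AbelianVariety ℂ} (hX : Domination.AVDominatedBy X (⨁ fun j => A (κ j))) : HodgeConjectureFor X.dim X.X :=
  Domination.hodgeConjectureFor_of_avDominatedBy
    (hodgeConjectureFor_biproduct_comp_of_sexticsOcticsDecics_of_isEmpty_ringHom_of_octics_of_finrank_pair hW4 hM6 n p hnp κ h2 hdeg im hA hΨ hp h24 hiso
      hout43) hX

/-! ## §2 Octic fields only -/

/-- **OCTIC FIELDS ONLY — ANY NUMBER OF `(1,3)`- AND `(2,2)`-FOURFOLDS OVER PAIRWISE NON-ISOMORPHIC OCTIC CM FIELDS THROUGH `k` WITH QUARTIC PART `𝔄₄` OR `𝔖₄`;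
GIVEN ONLY MARKMAN'S TWO THEOREMS.**  `k = Kf i₀` imaginary quadratic, `E = A 0 ⊨ (k; {τ})`, `B_m = A (m+1) ⊨ (K_m; Φ (m+1))` over OCTIC CM fields `K_m ⊇ i_m(k)` with `1` or `2`
members of `Φ (m+1)` over `τ` (CM fourfolds of `k`-signature `(1,3)` or `(2,2)`); for every `m` two `τ`-embeddings generate with `τ(k)` a field of degree `24`; `Hom(K_m, K_{m₀}) = ∅`
for `m₀ ≠ m`.  Then HC holds for EVERY product of copies `E^a × ∏_m B_m^{b_m}` (Z4's octic headline with its closure hypothesis discharged).  `HC_CM` is NOT asserted.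
[cite: Markman2025SurveySecant, Thm. 1.2] [cite: Markman2025SecantWeil, Thm 1.5.1] [cite: Pohlmann1968, Thm 1] [cite: MoonenZarhin1995Duke, Thm. 2.4] [cite: DixonMortimer1996, §1.4; §2.1]
[cite: Lang2002, VI §1 Thm. 1.1 and Cor. 1.6] -/
theorem hodgeConjectureFor_biproduct_comp_of_octics_of_isEmpty_ringHom_of_finrank_pair (hW4 : Markman2025_weilClasses_algebraic_abelianFourfold)
    (hM6 : Markman2025_weilClasses_algebraic_hyperbolicSixfold) (p : Fin r → ℕ) (hp12 : ∀ m, p m = 1 ∨ p m = 2)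
    {N : ℕ} (κ : Fin N → Fin (r + 1)) (h2 : Module.finrank ℚ (Kf i₀) = 2) (h8 : ∀ m : Fin r, Module.finrank ℚ (Kf (is m)) = 8)
    (im : ∀ m : Fin r, Kf i₀ →+* Kf (is m)) (hA : ∀ j, IsCMTypeRealisation (Φ j) (A j) (ι j) (θ j)) (hΨ : ∀ σ : Kf i₀ →+* ℂ, σ ∈ (Φ 0).1 ↔ σ = τ)
    (hp : ∀ m : Fin r, (Finset.univ.filter fun s : Kf (is m) →+* ℂ => s.comp (im m) = τ ∧ s ∈ (Φ m.succ).1).card = p m)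
    (h24 : ∀ m : Fin r, ∃ s₀ t₀ : Kf (is m) →+* ℂ, s₀.comp (im m) = τ ∧ t₀.comp (im m) = τ ∧ s₀ ≠ t₀ ∧
      Module.finrank ℚ ↥(adjoin ℚ (Set.range τ) ⊔ adjoin ℚ (Set.range s₀ ∪ Set.range t₀)) = 24)
    (hiso : ∀ (m₀ m : Fin r), m₀ ≠ m → IsEmpty (Kf (is m) →+* Kf (is m₀))) :
    HodgeConjectureFor (⨁ fun j => A (κ j)).dim (⨁ fun j => A (κ j)).X :=
  hodgeConjectureFor_biproduct_comp_of_sexticsOcticsDecics_of_isEmpty_ringHom_of_octics_of_finrank_pair hW4 hM6 (fun _ => 4) p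
    (fun m => (hp12 m).elim (fun h => Or.inr (Or.inl ⟨rfl, h⟩)) fun h => Or.inr (Or.inr (Or.inl ⟨rfl, h⟩))) κ h2 (fun m => by rw [h8 m]) im hA hΨ hp
    (fun m _ => h24 m) (fun m₀ m hm _ => hiso m₀ m hm) fun _ _ _ _ h3 => absurd h3 (by norm_num)

/-- **Dominated form, octic fields only.** [cite: Markman2025SurveySecant, Thm. 1.2] [cite: Markman2025SecantWeil, Thm 1.5.1] [cite: MumfordAV1970, §19] -/
theorem hodgeConjectureFor_of_avDominatedBy_comp_of_octics_of_isEmpty_ringHom_of_finrank_pair (hW4 : Markman2025_weilClasses_algebraic_abelianFourfold)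
    (hM6 : Markman2025_weilClasses_algebraic_hyperbolicSixfold) (p : Fin r → ℕ) (hp12 : ∀ m, p m = 1 ∨ p m = 2)
    {N : ℕ} (κ : Fin N → Fin (r + 1)) (h2 : Module.finrank ℚ (Kf i₀) = 2) (h8 : ∀ m : Fin r, Module.finrank ℚ (Kf (is m)) = 8)
    (im : ∀ m : Fin r, Kf i₀ →+* Kf (is m)) (hA : ∀ j, IsCMTypeRealisation (Φ j) (A j) (ι j) (θ j)) (hΨ : ∀ σ : Kf i₀ →+* ℂ, σ ∈ (Φ 0).1 ↔ σ = τ)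
    (hp : ∀ m : Fin r, (Finset.univ.filter fun s : Kf (is m) →+* ℂ => s.comp (im m) = τ ∧ s ∈ (Φ m.succ).1).card = p m)
    (h24 : ∀ m : Fin r, ∃ s₀ t₀ : Kf (is m) →+* ℂ, s₀.comp (im m) = τ ∧ t₀.comp (im m) = τ ∧ s₀ ≠ t₀ ∧
      Module.finrank ℚ ↥(adjoin ℚ (Set.range τ) ⊔ adjoin ℚ (Set.range s₀ ∪ Set.range t₀)) = 24)
    (hiso : ∀ (m₀ m : Fin r), m₀ ≠ m → IsEmpty (Kf (is m) →+* Kf (is m₀)))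
    {X : AbelianVariety ℂ} (hX : Domination.AVDominatedBy X (⨁ fun j => A (κ j))) : HodgeConjectureFor X.dim X.X :=
  Domination.hodgeConjectureFor_of_avDominatedBy
    (hodgeConjectureFor_biproduct_comp_of_octics_of_isEmpty_ringHom_of_finrank_pair hW4 hM6 p hp12 κ h2 h8 im hA hΨ hp h24 hiso) hX

/-! ## §3 The quotable form: simple factors, pairwise non-isomorphic fields in each degree -/

/-- **THE MENU, QUOTABLE FORM, NON-ISOMORPHIC FIELDS — GIVEN ONLY MARKMAN'S FOURFOLD AND HYPERBOLIC-SIXFOLD THEOREMS.**  `k = Kf i₀` an imaginary quadratic field, `E = A 0 ⊨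
(k; {τ})` its CM elliptic curve; `B_m = A (m+1) ⊨ (K_m; Φ (m+1))` CM abelian varieties over CM fields `K_m ⊇ i_m(k)` with `[K_m : k] = n_m ∈ {3, 4, 5}` such that: `B_m` is SIMPLE
when `n_m ∈ {3, 4}` (simple CM threefolds, simple CM fourfolds); the type of `B_m` has `2` or `3` members over `τ` when `n_m = 5` (CM fivefolds of `k`-signature `(2,3)` ∕ `(3,2)`);
for every OCTIC `K_m` two distinct `τ`-embeddings `s₀, t₀` have `[ℚ(τk)·s₀(K_m)·t₀(K_m) : ℚ] = 24` (quartic part `𝔄₄` or `𝔖₄`); `Hom(K_m, K_{m₀}) = ∅` for all `m₀ ≠ m` of EQUAL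
degree (the fields of each degree PAIRWISE NON-ISOMORPHIC); for `K_{m₀}` OCTIC and `K_m` SEXTIC some `τ`-embedding of `K_m` takes some value outside `L(K_{m₀})`.  Then the Hodge
conjecture holds for EVERY product of copies `⨁_j A(κ j)` — `E^a × ∏_m B_m^{b_m}`, any exponents, any order.  `HC_CM` is NOT asserted. [cite: Markman2025SurveySecant, Thm. 1.2]
[cite: Markman2025SecantWeil, Thm 1.5.1] [cite: Shimura1998, §8.2 Prop. 26] [cite: Deligne1982HodgeCycles, §5 (b)] [cite: Dodson1984, §1.1 Imprimitivity Theorem and §5.1.2 Theorem]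
[cite: DixonMortimer1996, §1.4 Ex. 1.4.1–1.4.2; §2.1; §3.3, Thm. 3.3A] [cite: Lang2002, VI §1 Thm. 1.1, Cor. 1.6 and V §2 Thm. 2.8] -/
theorem hodgeConjectureFor_biproduct_comp_menu_of_isSimple_of_isEmpty_ringHom (hW4 : Markman2025_weilClasses_algebraic_abelianFourfold)
    (hM6 : Markman2025_weilClasses_algebraic_hyperbolicSixfold) (n : Fin r → ℕ) (hn : ∀ m, n m = 3 ∨ n m = 4 ∨ n m = 5)
    {N : ℕ} (κ : Fin N → Fin (r + 1)) (h2 : Module.finrank ℚ (Kf i₀) = 2) (hdeg : ∀ m : Fin r, Module.finrank ℚ (Kf (is m)) = 2 * n m)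
    (im : ∀ m : Fin r, Kf i₀ →+* Kf (is m)) (hA : ∀ j, IsCMTypeRealisation (Φ j) (A j) (ι j) (θ j)) (hΨ : ∀ σ : Kf i₀ →+* ℂ, σ ∈ (Φ 0).1 ↔ σ = τ)
    (hS : ∀ m : Fin r, n m = 3 ∨ n m = 4 → (A m.succ).IsSimple)
    (h23 : ∀ m : Fin r, n m = 5 → (Finset.univ.filter fun s : Kf (is m) →+* ℂ => s.comp (im m) = τ ∧ s ∈ (Φ m.succ).1).card = 2 ∨
      (Finset.univ.filter fun s : Kf (is m) →+* ℂ => s.comp (im m) = τ ∧ s ∈ (Φ m.succ).1).card = 3)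
    (h24 : ∀ m : Fin r, n m = 4 → ∃ s₀ t₀ : Kf (is m) →+* ℂ, s₀.comp (im m) = τ ∧ t₀.comp (im m) = τ ∧ s₀ ≠ t₀ ∧
      Module.finrank ℚ ↥(adjoin ℚ (Set.range τ) ⊔ adjoin ℚ (Set.range s₀ ∪ Set.range t₀)) = 24)
    (hiso : ∀ (m₀ m : Fin r), m₀ ≠ m → n m₀ = n m → IsEmpty (Kf (is m) →+* Kf (is m₀)))
    (hout43 : ∀ (m₀ m : Fin r), m₀ ≠ m → n m₀ = 4 → n m = 3 → ∃ s : Kf (is m) →+* ℂ, s.comp (im m) = τ ∧ ∃ x, s x ∉ normalClosure ℚ (Kf (is m₀)) ℂ) :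
    HodgeConjectureFor (⨁ fun j => A (κ j)).dim (⨁ fun j => A (κ j)).X := by
  refine hodgeConjectureFor_biproduct_comp_menu_of_isSimple hW4 hM6 n hn κ h2 hdeg im hA hΨ hS h23 h24 (fun m₀ m hm hnm _ => hiso m₀ m hm hnm)
    fun m₀ m hm h4₀ hnm => ?_
  rcases hnm with h4 | h3
  · exact exists_outside_normalClosure_of_isEmpty_ringHom_four h2 hdeg im m₀ m h4₀ h4 (h2T_of_finrank_pair_octic h2 im hdeg h24 m₀ h4₀)
      (hiso m₀ m hm (h4₀.trans h4.symm))
  · exact hout43 m₀ m hm h4₀ h3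

/-- **Dominated form of the quotable form**: every complex abelian variety dominated by such a product of copies satisfies the Hodge conjecture, GIVEN ONLY Markman's two theorems.
`HC_CM` is NOT asserted. [cite: Markman2025SurveySecant, Thm. 1.2] [cite: Markman2025SecantWeil, Thm 1.5.1] [cite: MumfordAV1970, §19] -/
theorem hodgeConjectureFor_of_avDominatedBy_comp_menu_of_isSimple_of_isEmpty_ringHom (hW4 : Markman2025_weilClasses_algebraic_abelianFourfold)
    (hM6 : Markman2025_weilClasses_algebraic_hyperbolicSixfold) (n : Fin r → ℕ) (hn : ∀ m, n m = 3 ∨ n m = 4 ∨ n m = 5)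
    {N : ℕ} (κ : Fin N → Fin (r + 1)) (h2 : Module.finrank ℚ (Kf i₀) = 2) (hdeg : ∀ m : Fin r, Module.finrank ℚ (Kf (is m)) = 2 * n m)
    (im : ∀ m : Fin r, Kf i₀ →+* Kf (is m)) (hA : ∀ j, IsCMTypeRealisation (Φ j) (A j) (ι j) (θ j)) (hΨ : ∀ σ : Kf i₀ →+* ℂ, σ ∈ (Φ 0).1 ↔ σ = τ)
    (hS : ∀ m : Fin r, n m = 3 ∨ n m = 4 → (A m.succ).IsSimple)
    (h23 : ∀ m : Fin r, n m = 5 → (Finset.univ.filter fun s : Kf (is m) →+* ℂ => s.comp (im m) = τ ∧ s ∈ (Φ m.succ).1).card = 2 ∨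
      (Finset.univ.filter fun s : Kf (is m) →+* ℂ => s.comp (im m) = τ ∧ s ∈ (Φ m.succ).1).card = 3)
    (h24 : ∀ m : Fin r, n m = 4 → ∃ s₀ t₀ : Kf (is m) →+* ℂ, s₀.comp (im m) = τ ∧ t₀.comp (im m) = τ ∧ s₀ ≠ t₀ ∧
      Module.finrank ℚ ↥(adjoin ℚ (Set.range τ) ⊔ adjoin ℚ (Set.range s₀ ∪ Set.range t₀)) = 24)
    (hiso : ∀ (m₀ m : Fin r), m₀ ≠ m → n m₀ = n m → IsEmpty (Kf (is m) →+* Kf (is m₀)))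
    (hout43 : ∀ (m₀ m : Fin r), m₀ ≠ m → n m₀ = 4 → n m = 3 → ∃ s : Kf (is m) →+* ℂ, s.comp (im m) = τ ∧ ∃ x, s x ∉ normalClosure ℚ (Kf (is m₀)) ℂ)
    {X : AbelianVariety ℂ} (hX : Domination.AVDominatedBy X (⨁ fun j => A (κ j))) : HodgeConjectureFor X.dim X.X :=
  Domination.hodgeConjectureFor_of_avDominatedBy
    (hodgeConjectureFor_biproduct_comp_menu_of_isSimple_of_isEmpty_ringHom hW4 hM6 n hn κ h2 hdeg im hA hΨ hS h23 h24 hiso hout43) hX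

/-! ## §4 Sextic twin pairs inside the menu -/

/-- **SEXTIC TWIN PAIRS INSIDE THE MENU, NON-ISOMORPHIC FIELDS** — T3c's `hodgeConjectureFor_biproduct_comp_of_twinsMenu` with the octic–octic closure hypothesis replaced by
`Hom(K_m, K_{m₀}) = ∅`: `E` + pairs `B_m ≁ B_{tw m}` of SIMPLE CM threefolds over ONE sextic field each + further SIMPLE CM threefolds + SIMPLE CM fourfolds (octic fields with a
degree-`24` pair) + CM fivefolds of `k`-signature `(2,3)`/`(3,2)`, all through `k`; `Hom = ∅` across distinct units of EQUAL degree; for `K_{m₀}` octic, `K_m` sextic a value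
outside the closure ⟹ HC for EVERY product of copies, mod Markman 4 + 6.  `HC_CM` is NOT asserted. [cite: Markman2025SurveySecant, Thm. 1.2] [cite: Markman2025SecantWeil, Thm 1.5.1]
[cite: Shimura1998, §6.1 Corollary of Theorem 2, §8.2 Prop. 26, §18.2] [cite: Deligne1982HodgeCycles, §5 (b)] [cite: DixonMortimer1996, §1.4 Ex. 1.4.1–1.4.2; §2.1; §3.3, Thm. 3.3A]
[cite: Dodson1984, §1.1 Imprimitivity Theorem and §5.1.2 Theorem] -/
theorem hodgeConjectureFor_biproduct_comp_of_twinsMenu_of_isEmpty_ringHom (hW4 : Markman2025_weilClasses_algebraic_abelianFourfold)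
    (hM6 : Markman2025_weilClasses_algebraic_hyperbolicSixfold) {N : ℕ} (κ : Fin N → Fin (r + 1)) (h2 : Module.finrank ℚ (Kf i₀) = 2) (nI : I → ℕ)
    (hnI : ∀ m : Fin r, nI (is m) = 3 ∨ nI (is m) = 4 ∨ nI (is m) = 5) (hdeg : ∀ m : Fin r, Module.finrank ℚ (Kf (is m)) = 2 * nI (is m))
    (iK : ∀ i : I, Kf i₀ →+* Kf i) (hA : ∀ j, IsCMTypeRealisation (Φ j) (A j) (ι j) (θ j)) (hΨ : ∀ σ : Kf i₀ →+* ℂ, σ ∈ (Φ 0).1 ↔ σ = τ)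
    (tw : Fin r → Fin r) (htw : ∀ m, tw (tw m) = m) (hι : ∀ m, is (tw m) = is m) (htw3 : ∀ m, tw m ≠ m → nI (is m) = 3)
    (hS : ∀ m : Fin r, nI (is m) = 3 ∨ nI (is m) = 4 → (A m.succ).IsSimple)
    (h23 : ∀ m : Fin r, nI (is m) = 5 → (Finset.univ.filter fun s : Kf (is m) →+* ℂ => s.comp (iK (is m)) = τ ∧ s ∈ (Φ m.succ).1).card = 2 ∨
      (Finset.univ.filter fun s : Kf (is m) →+* ℂ => s.comp (iK (is m)) = τ ∧ s ∈ (Φ m.succ).1).card = 3)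
    (hni : ∀ m, tw m ≠ m → ¬ AbelianVariety.IsIsogenous (A m.succ) (A (tw m).succ))
    (h24 : ∀ m : Fin r, nI (is m) = 4 → ∃ s₀ t₀ : Kf (is m) →+* ℂ, s₀.comp (iK (is m)) = τ ∧ t₀.comp (iK (is m)) = τ ∧ s₀ ≠ t₀ ∧
      Module.finrank ℚ ↥(adjoin ℚ (Set.range τ) ⊔ adjoin ℚ (Set.range s₀ ∪ Set.range t₀)) = 24)
    (hiso : ∀ m₀ m : Fin r, m₀ ≠ m → tw m₀ ≠ m → nI (is m₀) = nI (is m) → IsEmpty (Kf (is m) →+* Kf (is m₀)))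
    (hout43 : ∀ m₀ m : Fin r, m₀ ≠ m → nI (is m₀) = 4 → nI (is m) = 3 →
      ∃ s : Kf (is m) →+* ℂ, s.comp (iK (is m)) = τ ∧ ∃ x, s x ∉ normalClosure ℚ (Kf (is m₀)) ℂ) :
    HodgeConjectureFor (⨁ fun j => A (κ j)).dim (⨁ fun j => A (κ j)).X := by
  refine hodgeConjectureFor_biproduct_comp_of_twinsMenu hW4 hM6 κ h2 nI hnI hdeg iK hA hΨ tw htw hι htw3 hS h23 hni h24
    (fun m₀ m hm htm hnm _ => hiso m₀ m hm htm hnm) fun m₀ m hm h4₀ hnm => ?_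
  rcases hnm with h4 | h3
  · -- two octic units are never twins (`htw3`), so `Hom = ∅` is available
    have htm : tw m₀ ≠ m := fun h => by
      have h4' : nI (is m₀) = 3 := htw3 m₀ (fun h' => hm (h'.symm.trans h))
      omega
    exact exists_outside_normalClosure_of_isEmpty_ringHom_four (n := fun l => nI (is l)) h2 hdeg (fun l => iK (is l)) m₀ m h4₀ h4
      (h2T_of_finrank_pair_octic h2 (fun l => iK (is l)) hdeg h24 m₀ h4₀) (hiso m₀ m hm htm (h4₀.trans h4.symm))
  · exact hout43 m₀ m hm h4₀ h3

end Headline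

end Summit.HodgeConjecture.CorCM.MultiFieldWeil

end
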